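import Mathlib
import HarnessLib
import Literature.NumberTheory.LFunctions.WeilExplicit
import Literature.NumberTheory.DiophantineGeometry.NamedHypotheses
import Literature.NumberTheory.LFunctions.DeBruijnNewman
import Summits.RiemannHypothesis.RiemannHypothesis.Theses.SpectralTrace

/-!
# Sketch — crux-ideate `stmt-RiemannHypothesis-11196` (`SpectralTrace.WindowTracePrime2`),
ideator 3, round 1.  First lemmas of two idea cards, stated over existing declarations only
(no proofs claimed; this file must elaborate, rc 0).

* Card `project-and-heal`: `offLineDefect`, `OffLineDefectFormula`, `OffLineDefectBound`
  (PROVED below: `offLineDefectFormula_holds`, `offLineDefectBound_holds`), the zeta-free transfer `HealingTransfer`, and the glue claim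
  `HealingGlue : HealingTransfer T₁ → RiemannHypothesisUpTo T₁ → WindowTracePrime2`.
* Card `one-prime-xi`: the X-form `OnePrimeXi` (an even real entire function with critical zeros
  and the one-prime template `s(s-1)/2 · π^{-s/2} Γ(s/2) · exp(2^{-s}) · (C + O(3^{-σ}))`), the claim
  `OnePrimeXi_implies_crux : OnePrimeXi → WindowTracePrime2`, the converse direction
  `crux_implies_OnePrimeXi`, the polynomial-accuracy ladder `ArchTemplate k`, and the explicit
  second-order Pólya kernel `polyaKernel₂` used by the card's cheapest falsifier.
-/

noncomputable section

open Complex MeasureTheory Set Filter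
open scoped Real Topology

namespace Summit.RiemannHypothesis.RiemannHypothesis.Cruxes.WindowTracePrime2.Ideator3

open Literature.NumberTheory.LFunctions
open Literature.NumberTheory.DiophantineGeometry (RiemannHypothesisUpTo)

/-! ## Common vocabulary: a real family reproduces a functional on the window `[-log 3, log 3]` -/

/-- `Reproduces γ Φ`: the real family `γ` reproduces the functional `Φ` on every Weil test
supported in the closed window `[-log 3, log 3]` (the shape of the crux with `Φ = weilFunctional`). -/
def Reproduces {κ : Type} (γ : κ → ℝ) (Φ : (ℝ → ℂ) → ℂ) : Prop :=
  ∀ g : ℝ → ℂ, IsWeilTest g → tsupport g ⊆ Icc (-Real.log 3) (Real.log 3) →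
    HasSum (fun k => weilMellin g (1 / 2 + (γ k : ℂ) * I)) (Φ g)

/-- Sanity: the crux is `∃ family, Reproduces family weilFunctional`. -/
example : Theses.SpectralTrace.WindowTracePrime2 ↔
    ∃ (ι : Type) (γ : ι → ℝ), Reproduces γ weilFunctional := Iff.rfl

/-! ## Card `project-and-heal` -/

/-- The window defect of projecting an off-line pair `1/2 ± η + iγ` onto the line (two unit atoms at
`1/2 + iγ`): `ĝ(1/2+η+iγ) + ĝ(1/2-η+iγ) - 2 ĝ(1/2+iγ)`. -/
def offLineDefect (η γ : ℝ) (g : ℝ → ℂ) : ℂ :=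
  weilMellin g (1 / 2 + η + γ * I) + weilMellin g (1 / 2 - η + γ * I)
    - 2 * weilMellin g (1 / 2 + γ * I)

/-- FIRST LEMMA (provable now, linearity of the integral): the defect is the Fourier coefficient at
`γ` of `g` multiplied by the small even weight `2(cosh(ηt) - 1)`; on the window `|t| ≤ log 3`,
`|η| ≤ 1/2`, this weight is at most `2(cosh(log 3 / 2) - 1) < 0.31`. -/
def OffLineDefectFormula : Prop :=
  ∀ (η γ : ℝ) (g : ℝ → ℂ), IsWeilTest g →
    offLineDefect η γ g = ∫ t : ℝ, g t * (2 * (Real.cosh (η * t) - 1) : ℝ) * cexp (I * γ * t)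

/-- Uniform bound: for `|η| ≤ 1/2` and `g` supported in `[-L, L]`,
`‖offLineDefect η γ g‖ ≤ 2 (cosh(L/2) - 1) ‖g‖₁`, uniformly in `γ`. -/
def OffLineDefectBound : Prop :=
  ∀ (η γ L : ℝ) (g : ℝ → ℂ), IsWeilTest g → 0 ≤ L → tsupport g ⊆ Icc (-L) L → |η| ≤ 1 / 2 →
    ‖offLineDefect η γ g‖ ≤ 2 * (Real.cosh (L / 2) - 1) * ∫ t : ℝ, ‖g t‖

/-! ### Proofs of the two first lemmas (sorry-free) -/

theorem integrable_mul_cexp {g : ℝ → ℂ} (hg : IsWeilTest g) (c : ℂ) :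
    Integrable (fun t : ℝ => g t * cexp (c * t)) :=
  (hg.1.continuous.mul (by fun_prop)).integrable_of_hasCompactSupport hg.2.mul_right

theorem offLineDefect_integrand (η γ : ℝ) (g : ℝ → ℂ) (t : ℝ) :
    g t * cexp ((1 / 2 + η + γ * I - 1 / 2) * t) + g t * cexp ((1 / 2 - η + γ * I - 1 / 2) * t)
      - 2 * (g t * cexp ((1 / 2 + γ * I - 1 / 2) * t))
      = g t * (2 * (Real.cosh (η * t) - 1) : ℝ) * cexp (I * γ * t) := by
  have e1 : cexp ((1 / 2 + η + γ * I - 1 / 2) * t) = cexp (η * t) * cexp (I * γ * t) := by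
    rw [← Complex.exp_add]; congr 1; ring
  have e2 : cexp ((1 / 2 - η + γ * I - 1 / 2) * t) = cexp (-(η * t)) * cexp (I * γ * t) := by
    rw [← Complex.exp_add]; congr 1; ring
  have e3 : cexp ((1 / 2 + γ * I - 1 / 2) * t) = cexp (I * γ * t) := by
    congr 1; ring
  have hc : ((2 * (Real.cosh (η * t) - 1) : ℝ) : ℂ) = cexp (η * t) + cexp (-(η * t)) - 2 := by
    push_cast
    rw [mul_sub, Complex.two_cosh]
    ring
  rw [e1, e2, e3, hc]
  ring

theorem offLineDefectFormula_holds : OffLineDefectFormula := by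
  intro η γ g hg
  unfold offLineDefect weilMellin
  have hAB : Integrable (fun a : ℝ => g a * cexp ((1 / 2 + η + γ * I - 1 / 2) * a)
      + g a * cexp ((1 / 2 - η + γ * I - 1 / 2) * a)) :=
    (integrable_mul_cexp hg _).add (integrable_mul_cexp hg _)
  have hC : Integrable (fun a : ℝ => 2 * (g a * cexp ((1 / 2 + γ * I - 1 / 2) * a))) :=
    (integrable_mul_cexp hg _).const_mul 2
  rw [(integral_const_mul (2 : ℂ) (fun t : ℝ => g t * cexp ((1 / 2 + γ * I - 1 / 2) * t))).symm,
    ← integral_add (integrable_mul_cexp hg _) (integrable_mul_cexp hg _),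
    ← integral_sub hAB hC]
  refine integral_congr_ae (Eventually.of_forall fun t => ?_)
  exact offLineDefect_integrand η γ g t

theorem offLineDefectBound_holds : OffLineDefectBound := by
  intro η γ L g hg hL hsupp hη
  rw [offLineDefectFormula_holds η γ g hg]
  have hpt : ∀ t : ℝ, ‖g t * (2 * (Real.cosh (η * t) - 1) : ℝ) * cexp (I * γ * t)‖
      ≤ 2 * (Real.cosh (L / 2) - 1) * ‖g t‖ := by
    intro t
    by_cases ht : t ∈ tsupport g
    · have htL : |t| ≤ L := by
        have := hsupp ht
        rw [mem_Icc] at this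
        exact abs_le.2 this
      have hexp : ‖cexp (I * γ * t)‖ = 1 := by
        rw [show I * (γ : ℂ) * (t : ℂ) = ((γ * t : ℝ) : ℂ) * I by push_cast; ring]
        exact Complex.norm_exp_ofReal_mul_I _
      have hcosh : Real.cosh (η * t) ≤ Real.cosh (L / 2) := by
        rw [Real.cosh_le_cosh, abs_mul]
        calc |η| * |t| ≤ 1 / 2 * L := mul_le_mul hη htL (abs_nonneg _) (by norm_num)
          _ = |L / 2| := by rw [abs_of_nonneg (by linarith)]; ring
      have hw : 0 ≤ 2 * (Real.cosh (η * t) - 1) := by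
        have := Real.one_le_cosh (η * t); linarith
      rw [norm_mul, norm_mul, hexp, mul_one, Complex.norm_real, Real.norm_eq_abs, abs_of_nonneg hw]
      have hgn : 0 ≤ ‖g t‖ := norm_nonneg _
      nlinarith
    · have h0 : g t = 0 := image_eq_zero_of_notMem_tsupport ht
      have : 0 ≤ 2 * (Real.cosh (L / 2) - 1) := by
        have := Real.one_le_cosh (L / 2); linarith
      simp [h0]
  have hint : Integrable (fun t : ℝ => 2 * (Real.cosh (L / 2) - 1) * ‖g t‖) :=
    ((hg.1.continuous.norm).integrable_of_hasCompactSupport hg.2.norm).const_mul _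
  calc ‖∫ t : ℝ, g t * (2 * (Real.cosh (η * t) - 1) : ℝ) * cexp (I * γ * t)‖
      ≤ ∫ t : ℝ, ‖g t * (2 * (Real.cosh (η * t) - 1) : ℝ) * cexp (I * γ * t)‖ :=
        norm_integral_le_integral_norm _
    _ ≤ ∫ t : ℝ, 2 * (Real.cosh (L / 2) - 1) * ‖g t‖ :=
        integral_mono_of_nonneg (Eventually.of_forall fun t => norm_nonneg _) hint
          (Eventually.of_forall hpt)
    _ = 2 * (Real.cosh (L / 2) - 1) * ∫ t : ℝ, ‖g t‖ := integral_const_mul _ _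


/-- Even-stencil lemma (the healing move, pure approximation theory): the weight `2(cosh(ηt)-1)` of an
off-line pair is reproduced on `|t| ≤ L`, within `ε η²`, by the first-order effect
`-2 δ_k t sin(k n s t)` of SYMMETRIC REAL displacements `δ_k` of `K` shells of the sub-lattice of step
`n s ≈ max(|η|, s)` (`s` = local spacing), with `|δ_k| ≤ A · min(|η|, η²/s)`: the moments
`Σ_k (δ_k λ_k) λ_k^{2j} = (-1)^{j+1} η^{2j+2}/(2j+2)` are an average of Lagrange evaluations on
`[-η², 0]` at nodes `λ_k² ≥ η²`, hence bounded weights; the tail is factorial. -/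
def EvenStencil : Prop :=
  ∀ (L : ℝ), 0 < L → ∀ ε > 0, ∃ (K : ℕ) (A : ℝ), ∀ (η s : ℝ), 0 < |η| → |η| ≤ 1 / 2 → 0 < s → s ≤ 1 →
    ∃ (n : ℕ) (δ : ℕ → ℝ), 0 < n ∧ (∀ k, |δ k| ≤ A * min |η| (η ^ 2 / s)) ∧
      ∀ t : ℝ, |t| ≤ L →
        |2 * (Real.cosh (η * t) - 1) -
            ∑ k ∈ Finset.Icc 1 K, (-2 * δ k * t * Real.sin (k * n * s * t))| ≤ ε * η ^ 2

/-- TRANSFER `C⁺` (zeta-free harmonic analysis). For a countable configuration `ρ` in the strip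
above height `T₁` (symmetric under `ρ ↦ 1 - conj ρ` and conjugation, counting function within an
explicit `A log`-band of a smooth chirp, horizontal offsets with a Selberg-type budget
`Σ_{T<Im ρ≤2T} |Re ρ - 1/2| ≤ B T`) together with a real family `γ₀` below `T₁`, IF the total
functional `Φ(g) = Σ_{γ₀} ĝ(1/2+iγ₀) + Σ_ρ ĝ(ρ)` is non-negative on `g ⋆ g̃` (necessary), THEN some
real family reproduces `Φ` on the window. (The stiffness parameter is `χ(T₁) = log 3 / log(T₁/2π)`;
the card needs it small.) -/
def HealingTransfer (T₁ : ℝ) : Prop :=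
  ∀ (ι₀ : Type) (γ₀ : ι₀ → ℝ) (ι : Type) (ρ : ι → ℂ) (A B : ℝ),
    Countable ι₀ → Countable ι →
    (∀ i, |γ₀ i| ≤ T₁) →
    (∀ i, T₁ < |(ρ i).im| ∧ |(ρ i).re - 1 / 2| < 1 / 2) →
    (∀ i, ∃ j, ρ j = 1 - (starRingEnd ℂ) (ρ i)) → (∀ i, ∃ j, ρ j = (starRingEnd ℂ) (ρ i)) →
    (∀ T : ℝ, T₁ ≤ T →
      (Nat.card {i // T < (ρ i).im ∧ (ρ i).im ≤ T + 1} : ℝ) ≤ A * Real.log T) →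
    (∀ T : ℝ, T₁ ≤ T →
      HasSum (fun i : {i // T < (ρ i).im ∧ (ρ i).im ≤ 2 * T} => |(ρ i.1).re - 1 / 2|)
        (∑' i : {i // T < (ρ i).im ∧ (ρ i).im ≤ 2 * T}, |(ρ i.1).re - 1 / 2|) ∧
      (∑' i : {i // T < (ρ i).im ∧ (ρ i).im ≤ 2 * T}, |(ρ i.1).re - 1 / 2|) ≤ B * T) →
    (∀ g : ℝ → ℂ, IsWeilTest g → tsupport g ⊆ Icc (-Real.log 3) (Real.log 3) →
      Summable (fun i => weilMellin g (ρ i)) ∧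
      Summable (fun i => weilMellin g (1 / 2 + (γ₀ i : ℂ) * I))) →
    (∀ g : ℝ → ℂ, IsWeilTest g → tsupport g ⊆ Icc (-(Real.log 3 / 2)) (Real.log 3 / 2) →
      0 ≤ ((∑' i, weilMellin (weilConv g (weilReflect g)) (1 / 2 + (γ₀ i : ℂ) * I)) +
            ∑' i, weilMellin (weilConv g (weilReflect g)) (ρ i)).re) →
    ∃ (κ : Type) (γ : κ → ℝ),
      Reproduces γ (fun g => (∑' i, weilMellin g (1 / 2 + (γ₀ i : ℂ) * I)) + ∑' i, weilMellin g (ρ i))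

/-- GLUE (the arithmetic inputs are in the tree: `explicit_formula_holds`, `summable_norm_zeroSide`,
`riemann_von_mangoldt_holds`; the numerical fact is `RiemannHypothesisUpTo T₁`, e.g.
`riemannHypothesisUpTo_platt_trudgian`, `T₁ = 3 000 175 332 800`; the Selberg budget
`Σ_{γ≤T}(β-1/2)⁺ ≪ T` is Titchmarsh Thm 9.15(A)/Selberg and is to be vendored). -/
def HealingGlue (T₁ : ℝ) : Prop :=
  HealingTransfer T₁ → RiemannHypothesisUpTo T₁ → Theses.SpectralTrace.WindowTracePrime2

/-! ## Card `one-prime-xi` (the X-form) -/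

/-- The archimedean–polar factor of Riemann's `ξ`: `G(s) = s(s-1)/2 · π^{-s/2} Γ(s/2)`
(`ξ_R = G · ζ`). -/
def archFactor (s : ℂ) : ℂ :=
  s * (s - 1) / 2 * (π : ℂ) ^ (-s / 2) * Complex.Gamma (s / 2)

/-- The one-prime template `G(s) · exp(2^{-s})`: Euler factor at `2` exponentiated
(`ζ(s) e^{-2^{-s}} = exp(Σ_{n ≥ 3} Λ(n)/log n · n^{-s}) = 1 + O(3^{-σ})`). -/
def onePrimeTemplate (s : ℂ) : ℂ :=
  archFactor s * cexp ((2 : ℂ) ^ (-s))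

/-- X-FORM of the crux. An entire function of finite order, symmetric under `s ↦ 1 - s`, real on
the real axis, with ALL zeros on `Re s = 1/2`, asymptotic to the one-prime template with relative
error `O(3^{-σ})` uniformly as `σ → +∞`. ("A Beurling ξ-function with one prime".) -/
def OnePrimeXi : Prop :=
  ∃ (Y : ℂ → ℂ) (C : ℂ) (K c σ₀ : ℝ),
    Differentiable ℂ Y ∧ C ≠ 0 ∧
    (∀ s, ‖Y s‖ ≤ Real.exp (c * (1 + ‖s‖) ^ 2)) ∧
    (∀ s, Y (1 - s) = Y s) ∧ (∀ x : ℝ, (Y x).im = 0) ∧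
    (∀ s, Y s = 0 → s.re = 1 / 2) ∧
    (∀ s : ℂ, σ₀ ≤ s.re → ‖Y s / onePrimeTemplate s - C‖ ≤ K * (3 : ℝ) ^ (-s.re))

/-- FIRST LEMMA of the card (complex analysis, no arithmetic): an X-form witness gives the crux —
its zero ordinates, with multiplicity, reproduce the Weil functional on the window
(Hadamard product + `FT_ξ log|Y(ξ+iy)| = -(π/|t|) e^{-|y||t|} Σ_γ e^{iγt}` + Paley–Wiener for the
bounded analytic function `3^{s}(Y/template - C)` on a half-plane + the digamma form of
`weilArchTerm`). -/
def OnePrimeXi_implies_crux : Prop :=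
  OnePrimeXi → Theses.SpectralTrace.WindowTracePrime2

/-- Converse (so the transfer is an EQUIVALENCE, not a costume): from a witness family build
`Y(1/2+iz) := ∏ (1 - z²/γ²)` (genus-1 canonical product over the positive members) and read the
template off the window identity. -/
def crux_implies_OnePrimeXi : Prop :=
  Theses.SpectralTrace.WindowTracePrime2 → OnePrimeXi

/-- The polynomial-accuracy ladder below the archimedean rung: relative accuracy `O(|s|^{-k})`
(⟺ the window defect vanishes to order `k-1` at `t = 0`). `k = 1` is Pólya 1926 (his `Ξ*`);
every finite `k` is a target for explicit analytic even kernels; `k = ∞` then `O(2^{-σ})` is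
`WindowTraceArch`, and inserting `exp(2^{-s})` with `O(3^{-σ})` is this crux. -/
def ArchTemplate (k : ℕ) : Prop :=
  ∃ (Y : ℂ → ℂ) (C : ℂ) (K c σ₀ : ℝ),
    Differentiable ℂ Y ∧ C ≠ 0 ∧
    (∀ s, ‖Y s‖ ≤ Real.exp (c * (1 + ‖s‖) ^ 2)) ∧
    (∀ s, Y (1 - s) = Y s) ∧ (∀ x : ℝ, (Y x).im = 0) ∧
    (∀ s, Y s = 0 → s.re = 1 / 2) ∧
    (∀ s : ℂ, σ₀ ≤ s.re → ‖Y s / archFactor s - C‖ ≤ K * ‖s‖ ^ (-(k : ℝ)))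

/-- Pólya's kernel (1926): `Φ*(u) = 4π² cosh(9u/2) e^{-2π cosh 2u}`; its cosine transform has only
real zeros (Pólya) and matches `G` to relative `O(1/|s|)` — `ArchTemplate 1`. -/
def polyaKernel (u : ℝ) : ℝ :=
  4 * π ^ 2 * Real.cosh (9 * u / 2) * Real.exp (-2 * π * Real.cosh (2 * u))

/-- Second-order Pólya kernel (this card's falsifier object): even, analytic in `|Im u| < π/4`,
matching de Bruijn's `Φ` at `±∞` to relative `O(e^{-6|u|})` (so its transform matches `G` to
relative `O(|s|^{-3})`): `[4π² cosh(9u/2) - 6π cosh(5u/2)] · exp(-π (2cosh 2u - ½ sech 2u))`.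
Kit question: are all zeros of `z ↦ ∫₀^∞ polyaKernel₂ u · cos(zu) du` real? -/
def polyaKernel₂ (u : ℝ) : ℝ :=
  (4 * π ^ 2 * Real.cosh (9 * u / 2) - 6 * π * Real.cosh (5 * u / 2)) *
    Real.exp (-π * (2 * Real.cosh (2 * u) - 1 / (2 * Real.cosh (2 * u))))

/-- The cosine transform of a kernel (zeros at `z = γ`, ordinates of `s = 1/2 + iz`... in de
Bruijn's normalisation `H_0(z) = ξ(1/2 + iz/2)/8` one has zeros at `2γ`; here we use `cos(zu)` with
the kernel in the variable `u = t/2`-free form and let the card fix conventions numerically). -/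
def cosTransform (Φ : ℝ → ℝ) (z : ℂ) : ℂ :=
  ∫ u in Ioi (0 : ℝ), (Φ u : ℂ) * Complex.cos (z * u)

/-- Falsifier statement for the ladder: Pólya-2 is real-rooted (numerically testable; a non-real
zero at low height would be a generalised-Newman-type obstruction to the moment ladder). -/
def PolyaTwoRealRooted : Prop :=
  HasOnlyRealZeros (cosTransform polyaKernel₂)

end Summit.RiemannHypothesis.RiemannHypothesis.Cruxes.WindowTracePrime2.Ideator3
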